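import Literature.NumberTheory.EllipticCurves.Rank1Residual.X9TrivialPartner
import Literature.NumberTheory.EllipticCurves.ComplexMultiplicationShaRubinSelmerProofs
import Literature.NumberTheory.EllipticCurves.BSDRankZeroDensityProofs
import Literature.NumberTheory.EllipticCurves.Zhai2016.NonvanishingQuadraticTwists
import Literature.NumberTheory.EllipticCurves.Greenberg1999.TwoTorsionMuInvariant
import Literature.NumberTheory.EllipticCurves.Tamagawa
import Literature.NumberTheory.EllipticCurves.BSDQuadraticDescentPeriodEliminationProofs
import Summits.BirchSwinnertonDyer.Rank1Residual.X5.RationalTwoTorsionPoints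
import HarnessLib

/-!
# Route `AlignedTransportAtTwo`, crux C2 `MainConjectureOfRankZeroBSDAtTwo` (stmt-BirchSwinnertonDyer-22298):
# `Sel^(p)(W/ℚ) = 0` FROM MILLER'S `BSD(W,p)` IN ANALYTIC RANK ZERO AT A `p`-ADIC UNIT `L`-VALUE —
# the `2`-Selmer bit of the cubic Chevalley road is the crux's OWN hypothesis `BSD₂(W)` read at one rational number

HONEST FRAMING (cell `bsd-f1-sign2`, WIDTH-5 attached prover seat `bsd-line-att-p5` gen 30 on line `birth` of the lead `bsd-line-att-p2`;
`--supports` stmt-BirchSwinnertonDyer-22298, closes nothing; BSD is NOT proved by any of this; the crux C2, its verdict «blocked-on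
`Rank1Residual.GreenbergMuConjectureIrreducible`» and every registered stub are untouched). THEOREMS ONLY (no definition, no named fact,
no `sorry`); every input is a tree theorem. Sequel of att-p5 g29 `…CubicChevalleySelmerBit`: there the off-stratum cubic door into
`MC₂(W)` displays `hSel : W.selmerGroup 2 = ⊥` as a datum. This file discharges it from the crux's own hypothesis `hbsd : BSDp W 2`
(Miller's `BSD(E,2)`), `r_an(W) = 0`, «no rational `2`-torsion abscissa» and ONE rational number: `ord₂(L(W,1)/Ω_W) = 0` with odd
Tamagawa product (equivalently `ord₂ #Ш_an(W) = 0`).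

WHAT (generic prime `p` first, then the cell's `p = 2` shapes).
* `natCard_primaryComponent_sha_eq_one_of_bsdp_of_shaAn_unit`: `BSDp W p` and `#Ш_an(W) = q` with `ord_p q = 0` ⟹ `#Ш(W)[p^∞] = 1`;
  `sha_torsion_eq_zero_of_bsdp_of_shaAn_unit`: hence `Ш(W)[p] = 0` (`∀ x : Ш, p • x = 0 → x = 0`).
* `selmerGroup_eq_bot_of_bsdp_of_shaAn_unit`: + `r_an(W) = 0` + `E(ℚ)[p] = 0` ⟹ **`Sel^(p)(W/ℚ) = ⊥`** (`E(ℚ)` is finite by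
  `rank = r_an = 0` and Mordell–Weil, so `P ↦ pP` is onto; then Silverman X.4.2(a) in the tree's form
  `WeierstrassCurve.selmerGroup_eq_bot_of_sha_torsionBy_of_zsmul_surjective`).
* `shaAn_eq_of_analyticRank_eq_zero_of_lValue`, `padicValRat_shaAn_eq_of_lValue`: in analytic rank `0`, `#Ш_an = (L(W,1)/Ω_W)·#tors²/∏c_v`
  and, when `p ∤ #E(ℚ)_tors · ∏ c_v`, `ord_p #Ш_an = ord_p (L(W,1)/Ω_W)`;
  `selmerGroup_eq_bot_of_bsdp_of_lValue_unit`: **`BSDp W p`, `r_an = 0`, `E[p]` irreducible, `p ∤ ∏ c_v`, `L(W,1)/Ω_W = q ≠ 0` with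
  `ord_p q = 0` ⟹ `Sel^(p)(W/ℚ) = ⊥`.**
* `p = 2`, cell binders: `selmerGroup_two_eq_bot_of_bsdp` (`ht : ∀ x, ¬ HasRationalTwoTorsionX W x`, `Odd (∏ c_v)`, `L(W,1)/Ω_W` odd) and
  `selmerGroup_two_eq_bot_of_bsdp_of_isLAlg` (Zhai's datum `ord₂ L^{alg}(W,1) = 0` with `Ω_∞ = Ω_W` on `Δ_W < 0`).
* Converse bookkeeping: `sha_torsion_eq_zero_of_selmerGroup_eq_bot` / `natCard_primaryComponent_sha_eq_one_of_selmerGroup_eq_bot` /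
  `padicValRat_lValue_eq_zero_of_bsdp_of_selmerGroup_eq_bot`: `Sel^(p) = ⊥` ⟹ `Ш[p^∞] = 0` ⟹ (`BSDp`, rank `0`, `p ∤ #tors·∏c_v`)
  `ord_p(L(W,1)/Ω_W) = 0`; so on the cell **`Sel₂(W/ℚ) = ⊥ ⟺ ord₂(L(W,1)/Ω_W) = 0`** granted `BSD₂(W)`.

READING (for the planner-of-record). On the off-stratum `Δ_W < 0` cubic `(0,1)`-Chevalley road (g28/g29) the displayed inputs become:
PRINT⁵ + `hYY` (Brumer–Kramer/Yoo–Yu, print) + MuIneqʳ + the crux's cell binders (`hord`, `ht`, `hΔ`, `hr`, `hbsd`) + `Odd (∏ c_v)` +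
«`ord₂(L(W,1)/Ω_W) = 0`» + the integer certificates of one unit of `ℚ(β)` — NO class group, NO Selmer group, NO analytic-`μ` hypothesis
(see the sibling `…CubicChevalleyLValueBit`). CONDITIONAL on nothing here (all theorems); nothing is asserted about any curve; BSD is not proved.

References: [Miller2011LMS] Def. 1.1 (`BSD(E,p)`); [SilvermanAEC2009] Thm. X.4.2 (a) (the `n`-descent sequence), VIII.6.7 (Mordell–Weil);
[Zhai2016] §1 (`L^{alg}`, `Ω_∞`); tree: `Rank1Residual/X9TrivialPartner` (`natCard_selmerGroupPInfty_eq_one_of_bsdp`, the `p^∞` template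
whose valuation bookkeeping is repeated here for `Sel^(p)`), `ComplexMultiplicationShaRubinSelmerProofs`, `MordellWeilRankZeroProofs`,
`BSDRankZeroDensityProofs` (`natCard_selmerGroup_eq`).
-/

set_option linter.dupNamespace false
set_option autoImplicit false

noncomputable section

open scoped Classical AddSubgroup

namespace Summit.BirchSwinnertonDyer.BirchSwinnertonDyer.Theorems.AlignedTransportAtTwoSelmerTwoOfBSDp

open WeierstrassCurve NumberField Literature.NumberTheory.EllipticCurves Literature.NumberTheory.EllipticCurves.Rank1Residual
  Literature.NumberTheory.EllipticCurves.Greenberg1999 Literature.NumberTheory.EllipticCurves.Zhai2016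
  Literature.NumberTheory.EllipticCurves.CoatesLiTianZhai2015

variable (W : WeierstrassCurve ℚ) [W.IsElliptic] (p : ℕ) [hp : Fact p.Prime]

/-! ## §1 `Ш(W)[p] = 0` from `BSD(W,p)` at a `p`-adic unit `#Ш_an` -/

omit [W.IsElliptic] in
/-- **`BSD(W,p)` with `ord_p #Ш_an(W) = 0` ⟹ `#Ш(W)[p^∞] = 1`.** Miller's last clause gives `ord_p #Ш[p^∞] = ord_p #Ш_an = 0` (the rational
`q` with `#Ш_an = q` is unique), and a finite `p`-primary group has order `p^k`. [cite: Miller2011LMS, Def. 1.1 (arXiv:1010.2431 p. 3)] -/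
theorem natCard_primaryComponent_sha_eq_one_of_bsdp_of_shaAn_unit (hbsd : BSDp W p) {q : ℚ} (hq : shaAn W = (q : ℂ))
    (hv : padicValRat p q = 0) : Nat.card (AddCommGroup.primaryComponent W.sha p) = 1 := by
  obtain ⟨-, hfin, q', hq', hval⟩ := hbsd
  haveI := hfin
  have hqq : q' = q := by exact_mod_cast hq'.symm.trans hq
  subst hqq
  rw [hv] at hval
  obtain ⟨k, hk⟩ := exists_card_addPrimaryComponent_eq_pow (A := W.sha) p
  rw [hk, padicValNat.prime_pow] at hval
  have hk0 : k = 0 := by exact_mod_cast hval.symm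
  rw [hk, hk0, pow_zero]

omit [W.IsElliptic] in
/-- **`BSD(W,p)` with `ord_p #Ш_an(W) = 0` ⟹ `Ш(W)[p] = 0`**: every class of `Ш(W)` killed by `p` lies in the trivial group `Ш(W)[p^∞]`.
The shape `∀ x : Ш, p • x = 0 → x = 0` is the certificate binder of the cell's per-curve `BSD(E,p)` records. [cite: Miller2011LMS, Def. 1.1] -/
theorem sha_torsion_eq_zero_of_bsdp_of_shaAn_unit (hbsd : BSDp W p) {q : ℚ} (hq : shaAn W = (q : ℂ)) (hv : padicValRat p q = 0) :
    ∀ x : W.sha, (p : ℤ) • x = 0 → x = 0 := by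
  have h1 := natCard_primaryComponent_sha_eq_one_of_bsdp_of_shaAn_unit W p hbsd hq hv
  haveI : Finite (AddCommGroup.primaryComponent W.sha p) := hbsd.2.1
  intro x hx
  have hmem : x ∈ AddCommGroup.primaryComponent W.sha p :=
    (AddCommGroup.mem_primaryComponent).mpr ⟨1, by rw [pow_one, ← natCast_zsmul]; exact hx⟩
  have hsub : Subsingleton (AddCommGroup.primaryComponent W.sha p) := Nat.card_eq_one_iff_unique.mp h1 |>.1
  have h0 : (⟨x, hmem⟩ : AddCommGroup.primaryComponent W.sha p) = 0 := Subsingleton.elim _ _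
  exact congrArg Subtype.val h0

/-! ## §2 `Sel^(p)(W/ℚ) = ⊥` in analytic rank zero -/

omit hp in
/-- **Rank `0` and `E(ℚ)[p] = 0` ⟹ `P ↦ pP` is onto `E(ℚ)`**: `E(ℚ)` is finite (Mordell–Weil, tree `mordellWeilRank_eq_zero_iff_finite`) and
multiplication by `p` is injective on it. [cite: SilvermanAEC2009, Thm. VIII.6.7 and Ch. VIII intro] -/
theorem zsmul_surjective_of_rank_zero_of_torsionFree (hr0 : W.mordellWeilRank = 0)
    (ht : ∀ P : W.toAffine.Point, (p : ℤ) • P = 0 → P = 0) :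
    Function.Surjective fun P : W.toAffine.Point => (p : ℤ) • P := by
  haveI : Finite W.toAffine.Point := W.mordellWeilRank_eq_zero_iff_finite.mp hr0
  refine Finite.surjective_of_injective fun P Q hPQ => ?_
  have hPQ' : (p : ℤ) • (P - Q) = 0 := by
    have hPQ'' : (p : ℤ) • P = (p : ℤ) • Q := hPQ
    rw [zsmul_sub, hPQ'', sub_self]
  exact sub_eq_zero.mp (ht (P - Q) hPQ')

/-- **`Sel^(p)(W/ℚ) = ⊥` FROM `BSD(W,p)` IN ANALYTIC RANK ZERO.** `BSDp W p` (rank `= r_an`, `Ш[p^∞]` finite, `ord_p #Ш_an = ord_p #Ш[p^∞]`),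
`r_an(W) = 0`, `E(ℚ)[p] = 0` and `#Ш_an(W) = q` with `ord_p q = 0` ⟹ the `p`-Selmer group is trivial: `Ш(W)[p] = 0` (§1) and `E(ℚ) = pE(ℚ)`,
so the descent sequence `0 → E(ℚ)/p → Sel^(p) → Ш[p] → 0` (Silverman X.4.2 (a), tree theorem
`WeierstrassCurve.selmerGroup_eq_bot_of_sha_torsionBy_of_zsmul_surjective`) has both ends zero. [cite: SilvermanAEC2009, Thm. X.4.2 (a)]
[cite: Miller2011LMS, Def. 1.1] -/
theorem selmerGroup_eq_bot_of_bsdp_of_shaAn_unit (hbsd : BSDp W p) (hr : W.analyticRank = 0)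
    (ht : ∀ P : W.toAffine.Point, (p : ℤ) • P = 0 → P = 0) {q : ℚ} (hq : shaAn W = (q : ℂ)) (hv : padicValRat p q = 0) :
    W.selmerGroup p = ⊥ := by
  have hp0 : ((p : ℕ) : ℤ) ≠ 0 := by exact_mod_cast hp.out.ne_zero
  have hr0 : W.mordellWeilRank = 0 := hbsd.1.trans hr
  refine W.selmerGroup_eq_bot_of_sha_torsionBy_of_zsmul_surjective hp0 (sha_torsion_eq_zero_of_bsdp_of_shaAn_unit W p hbsd hq hv) ?_
  -- the tree's general-number-field lemma carries the classical `DecidableEq` instance on `E(ℚ)`, ours the computable one on `ℚ`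
  -- (a subsingleton: `convert` closes the difference)
  convert zsmul_surjective_of_rank_zero_of_torsionFree W p hr0 ht

/-- `E[p]` irreducible ⟹ `E(ℚ)[p] = 0` in the shape `p • P = 0 → P = 0` (a rational point of order `p` spans a `Γ_ℚ`-line in `E[p]`; tree
`not_exists_addOrderOf_eq_of_hasIrreducibleModPGaloisRep`). [cite: Mazur1977, Ch. III §5, p. 157] -/
theorem forall_zsmul_eq_zero_of_irr (hirr : Irr W p) : ∀ P : W.toAffine.Point, (p : ℤ) • P = 0 → P = 0 := by
  intro P hP
  by_contra hP0
  have hPn : p • P = 0 := by rw [← natCast_zsmul]; exact hP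
  exact not_exists_addOrderOf_eq_of_hasIrreducibleModPGaloisRep W hirr ⟨P, addOrderOf_eq_prime hPn hP0⟩

/-! ## §3 The `L`-value form: `ord_p #Ш_an = ord_p (L(W,1)/Ω_W)` when `p ∤ #E(ℚ)_tors · ∏ c_v` -/

/-- **`#Ш_an` in analytic rank `0`**: if `L(W,1)/Ω_W = q` then `#Ш_an(W) = q · #E(ℚ)_tors² / ∏_v c_v` (`Reg = 1`, `L^{(0)}(W,1)/0! = L(W,1)`).
[cite: Miller2011LMS, §1 (arXiv:1010.2431 p. 3)] -/
theorem shaAn_eq_of_analyticRank_eq_zero_of_lValue (hr0 : W.mordellWeilRank = 0) (hr : W.analyticRank = 0) {q : ℚ}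
    (hL : W.entireLFunction 1 / (W.realPeriodRat : ℂ) = (q : ℂ)) :
    shaAn W = ((q * (W.torsionOrder : ℚ) ^ 2 / (W.tamagawaProduct : ℚ) : ℚ) : ℂ) := by
  have hΩ : 0 < W.realPeriodRat := W.realPeriodRat_pos_holds
  have hΩC : (W.realPeriodRat : ℂ) ≠ 0 := Complex.ofReal_ne_zero.mpr hΩ.ne'
  have hc : 0 < W.tamagawaProduct := W.tamagawaProduct_pos'
  have hReg : W.regulator = 1 := W.regulator_eq_one_of_rank_zero hr0
  have hL1 : W.entireLFunction 1 = (q : ℂ) * (W.realPeriodRat : ℂ) := by rw [← hL, div_mul_cancel₀ _ hΩC]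
  rw [shaAn_def, W.leadingLCoeff_eq_of_analyticRank_eq_zero hr, hL1, hReg]
  have hcC : ((W.tamagawaProduct : ℚ) : ℂ) ≠ 0 := by exact_mod_cast hc.ne'
  push_cast
  field_simp

/-- **`ord_p #Ш_an = ord_p (L(W,1)/Ω_W)`** in analytic rank `0` when `L(W,1)/Ω_W = q ≠ 0`, `p ∤ #E(ℚ)_tors` (irreducible `E[p]`) and
`p ∤ ∏_v c_v`. [cite: Miller2011LMS, §1] -/
theorem padicValRat_shaAn_eq_of_lValue (hirr : Irr W p) (htam : ¬ p ∣ W.tamagawaProduct) {q : ℚ} (hq0 : q ≠ 0) :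
    padicValRat p (q * (W.torsionOrder : ℚ) ^ 2 / (W.tamagawaProduct : ℚ)) = padicValRat p q := by
  have hT : 0 < W.torsionOrder := W.torsionOrder_pos_holds
  have hc : 0 < W.tamagawaProduct := W.tamagawaProduct_pos'
  have hT0 : (W.torsionOrder : ℚ) ≠ 0 := by exact_mod_cast hT.ne'
  have hc0 : (W.tamagawaProduct : ℚ) ≠ 0 := by exact_mod_cast hc.ne'
  rw [padicValRat.div (mul_ne_zero hq0 (pow_ne_zero 2 hT0)) hc0, padicValRat.mul hq0 (pow_ne_zero 2 hT0), padicValRat.pow,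
    padicValRat.of_nat, padicValRat.of_nat, padicValNat_torsionOrder_eq_zero_of_irreducible W p hirr, padicValNat.eq_zero_of_not_dvd htam]
  simp

/-- **`Sel^(p)(W/ℚ) = ⊥` FROM `BSD(W,p)` AT A `p`-ADIC UNIT `L`-VALUE.** For elliptic `W/ℚ` (intended globally minimal, so that `Ω_W`,
`∏ c_v`, `#Ш_an` are the BSD invariants): `BSDp W p`, `r_an(W) = 0`, `E[p]` irreducible, `p ∤ ∏_v c_v`, and `L(W,1)/Ω_W = q ≠ 0` with
`ord_p q = 0` ⟹ `Sel^(p)(W/ℚ) = ⊥`. (Then `ord_p #Ш_an = 0`, §3, and §2 applies with `E(ℚ)[p] = 0` from irreducibility.)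
[cite: Miller2011LMS, Def. 1.1] [cite: SilvermanAEC2009, Thm. X.4.2 (a)] -/
theorem selmerGroup_eq_bot_of_bsdp_of_lValue_unit (hbsd : BSDp W p) (hr : W.analyticRank = 0) (hirr : Irr W p)
    (htam : ¬ p ∣ W.tamagawaProduct)
    (hL : ∃ q : ℚ, q ≠ 0 ∧ W.entireLFunction 1 / (W.realPeriodRat : ℂ) = (q : ℂ) ∧ padicValRat p q = 0) :
    W.selmerGroup p = ⊥ := by
  obtain ⟨q, hq0, hqeq, hqv⟩ := hL
  have hr0 : W.mordellWeilRank = 0 := hbsd.1.trans hr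
  refine selmerGroup_eq_bot_of_bsdp_of_shaAn_unit W p hbsd hr (forall_zsmul_eq_zero_of_irr W p hirr)
    (shaAn_eq_of_analyticRank_eq_zero_of_lValue W hr0 hr hqeq) ?_
  rw [padicValRat_shaAn_eq_of_lValue W p hirr htam hq0, hqv]

/-! ## §4 The cell's `p = 2` shapes -/

/-- «No rational `2`-torsion abscissa» (the crux's binder `ht`) ⟹ `E[2]` irreducible (`Irr W 2`): a rational point `P = (x, y)` of order
`2` has `P = −P`, i.e. `2y + a₁x + a₃ = 0`, i.e. `HasRationalTwoTorsionX W x` (the computation of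
`…AlignedTransportAtTwoSeed.irr_two_of_forall_not_hasRationalTwoTorsionX`, repeated so that this file does not import the route cone).
[cite: SilvermanAEC2009, III.2.3] -/
theorem irr_two_of_forall_not_hasRationalTwoTorsionX (ht : ∀ x : ℚ, ¬ HasRationalTwoTorsionX W x) : Irr W 2 := by
  rw [Summit.BirchSwinnertonDyer.Rank1Residual.X5.O1.irr_two_iff_not_exists_addOrderOf_eq_two]
  rintro ⟨P, hP⟩
  have h2 : (2 : ℕ) • P = 0 := by rw [← hP]; exact addOrderOf_nsmul_eq_zero P
  have hP0 : P ≠ 0 := by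
    rintro rfl
    rw [addOrderOf_zero] at hP
    exact absurd hP (by norm_num)
  rcases P with _ | ⟨x, y, hns⟩
  · exact absurd rfl hP0
  · refine ht x ⟨y, hns.1, ?_⟩
    have hneg : (WeierstrassCurve.Affine.Point.some x y hns : W.toAffine.Point) = -WeierstrassCurve.Affine.Point.some x y hns :=
      eq_neg_of_add_eq_zero_left (by rwa [two_nsmul] at h2)
    rw [WeierstrassCurve.Affine.Point.neg_some, WeierstrassCurve.Affine.Point.some.injEq] at hneg
    have hy : y = -y - W.a₁ * x - W.a₃ := hneg.2
    linear_combination hy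

omit [W.IsElliptic] in
/-- Odd Tamagawa product ⟹ `2 ∤ ∏_v c_v` (bookkeeping). [folklore] -/
theorem not_two_dvd_tamagawaProduct_of_odd (htam : Odd W.tamagawaProduct) : ¬ 2 ∣ W.tamagawaProduct :=
  fun h => (Nat.not_even_iff_odd.mpr htam) (even_iff_two_dvd.mpr h)

/-- **THE CELL SHAPE: `Sel₂(W/ℚ) = ⊥` FROM THE CRUX'S OWN `BSD₂(W)`.** For elliptic `W/ℚ` (globally minimal on the cell) with `hbsd : BSDp W 2`,
`r_an(W) = 0`, no rational `2`-torsion abscissa (`ht`), `Odd (∏_v c_v)` and `L(W,1)/Ω_W = q ≠ 0` with `ord₂ q = 0`: the `2`-Selmer group of `W`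
is trivial. This is exactly the hypothesis `hSel` of att-p5 g29's class-group-free cubic door (`…CubicChevalleySelmerBit`).
[cite: Miller2011LMS, Def. 1.1] [cite: SilvermanAEC2009, Thm. X.4.2 (a)] -/
theorem selmerGroup_two_eq_bot_of_bsdp (hbsd : BSDp W 2) (hr : W.analyticRank = 0) (ht : ∀ x : ℚ, ¬ HasRationalTwoTorsionX W x)
    (htam : Odd W.tamagawaProduct)
    (hL : ∃ q : ℚ, q ≠ 0 ∧ W.entireLFunction 1 / (W.realPeriodRat : ℂ) = (q : ℂ) ∧ padicValRat 2 q = 0) :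
    W.selmerGroup 2 = ⊥ :=
  selmerGroup_eq_bot_of_bsdp_of_lValue_unit W 2 hbsd hr (irr_two_of_forall_not_hasRationalTwoTorsionX W ht)
    (not_two_dvd_tamagawaProduct_of_odd W htam) hL

omit [W.IsElliptic] in
/-- For `Δ_W < 0` the real locus is connected and Zhai's least real period `Ω_∞(W)` (`leastRealPeriod`) is the Néron period `Ω_W`
(`realPeriodRat`) (same statement as `…SignedMuAtTwo.leastRealPeriod_eq_realPeriodRat_of_delta_neg`, repeated to keep the imports in `Literature`).
[cite: Zhai2016, §1 (Ω_∞ the least real period)] -/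
theorem leastRealPeriod_eq_realPeriodRat_of_Δ_neg (hΔ : W.Δ < 0) : leastRealPeriod W = W.realPeriodRat := by
  unfold leastRealPeriod
  rw [numRealComponents_baseChange_real, if_neg (not_lt.mpr hΔ.le), Nat.cast_one, div_one]

/-- Zhai's datum «`ord₂ L^{alg}(W,1) = 0`» (`IsLAlg W x`: `L(W,1) = x · Ω_∞(W)`) in the tree's `L(W,1)/Ω_W` currency on `Δ_W < 0`.
[cite: Zhai2016, §1 (L^{alg} = L(E,1)/Ω_∞)] -/
theorem lValue_div_realPeriodRat_eq_of_isLAlg_of_Δ_neg (hΔ : W.Δ < 0) {x : ℚ} (hx : IsLAlg W x) :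
    W.entireLFunction 1 / (W.realPeriodRat : ℂ) = (x : ℂ) := by
  have hΩ : 0 < W.realPeriodRat := W.realPeriodRat_pos_holds
  have hΩC : (W.realPeriodRat : ℂ) ≠ 0 := Complex.ofReal_ne_zero.mpr hΩ.ne'
  unfold IsLAlg at hx
  rw [leastRealPeriod_eq_realPeriodRat_of_Δ_neg W hΔ] at hx
  rw [hx, mul_div_cancel_right₀ _ hΩC]

/-- **THE CELL SHAPE, ZHAI CURRENCY**: on `Δ_W < 0` (the cubic road's sign), `BSDp W 2`, `r_an(W) = 0`, `ht`, `Odd (∏_v c_v)` and Zhai's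
datum `∃ x, IsLAlg W x ∧ x ≠ 0 ∧ ord₂ x = 0` (the X5 table's column «`v₂(L/Ω) = 0`») ⟹ `Sel₂(W/ℚ) = ⊥`.
[cite: Zhai2016, §1] [cite: Miller2011LMS, Def. 1.1] [cite: SilvermanAEC2009, Thm. X.4.2 (a)] -/
theorem selmerGroup_two_eq_bot_of_bsdp_of_isLAlg (hΔ : W.Δ < 0) (hbsd : BSDp W 2) (hr : W.analyticRank = 0)
    (ht : ∀ x : ℚ, ¬ HasRationalTwoTorsionX W x) (htam : Odd W.tamagawaProduct)
    (hL : ∃ x : ℚ, IsLAlg W x ∧ x ≠ 0 ∧ padicValRat 2 x = 0) : W.selmerGroup 2 = ⊥ := by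
  obtain ⟨x, hx, hx0, hxv⟩ := hL
  exact selmerGroup_two_eq_bot_of_bsdp W hbsd hr ht htam ⟨x, hx0, lValue_div_realPeriodRat_eq_of_isLAlg_of_Δ_neg W hΔ hx, hxv⟩

/-! ## §5 Converse bookkeeping: `Sel^(p) = ⊥ ⟹ Ш[p^∞] = 0 ⟹ ord_p(L(W,1)/Ω_W) = 0` under `BSD(W,p)` -/

omit [W.IsElliptic] in
/-- `Sel^(p)(W/ℚ) = ⊥ ⟹ #Ш(W)[p^∞] = 1` (for finite `Ш[p^∞]`): a non-trivial finite `p`-group has an element of order `p`, which would be a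
class of `Ш` killed by `p`, and `Ш(W)[p] = 0` by `sha_torsionBy_eq_zero_of_selmerGroup_eq_bot_nat` (Silverman X.4.2 (a), surjectivity
half). [cite: SilvermanAEC2009, Thm. X.4.2 (a)] -/
theorem natCard_primaryComponent_sha_eq_one_of_selmerGroup_eq_bot [Finite (AddCommGroup.primaryComponent W.sha p)]
    (hSel : W.selmerGroup p = ⊥) : Nat.card (AddCommGroup.primaryComponent W.sha p) = 1 := by
  obtain ⟨k, hk⟩ := exists_card_addPrimaryComponent_eq_pow (A := W.sha) p
  rw [hk]
  rcases Nat.eq_zero_or_pos k with hk0 | hkpos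
  · rw [hk0, pow_zero]
  · exfalso
    have hdvd : p ∣ Nat.card (AddCommGroup.primaryComponent W.sha p) := by
      rw [hk]; exact dvd_pow_self p hkpos.ne'
    obtain ⟨x, hx⟩ := exists_prime_addOrderOf_dvd_card' (G := AddCommGroup.primaryComponent W.sha p) p hdvd
    have hx0 : x ≠ 0 := by
      intro h0
      rw [h0, addOrderOf_zero] at hx
      exact hp.out.one_lt.ne hx
    have hpx0 : p • x = 0 := by
      have h := addOrderOf_nsmul_eq_zero x
      rwa [hx] at h
    have hpx : p • (x : W.sha) = 0 := by
      rw [← AddSubgroupClass.coe_nsmul, hpx0, ZeroMemClass.coe_zero]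
    have := W.sha_torsionBy_eq_zero_of_selmerGroup_eq_bot_nat hp.out.ne_zero hSel (x : W.sha) hpx
    exact hx0 (Subtype.ext this)

omit [W.IsElliptic] in
/-- **`BSD(W,p)` and `Sel^(p)(W/ℚ) = ⊥` ⟹ `ord_p #Ш_an(W) = 0`** (the rational `q` with `#Ш_an = q`). [cite: Miller2011LMS, Def. 1.1] -/
theorem padicValRat_shaAn_eq_zero_of_bsdp_of_selmerGroup_eq_bot (hbsd : BSDp W p) (hSel : W.selmerGroup p = ⊥) {q : ℚ}
    (hq : shaAn W = (q : ℂ)) : padicValRat p q = 0 := by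
  obtain ⟨-, hfin, q', hq', hval⟩ := hbsd
  haveI := hfin
  have hqq : q' = q := by exact_mod_cast hq'.symm.trans hq
  subst hqq
  rw [hval, natCard_primaryComponent_sha_eq_one_of_selmerGroup_eq_bot W p hSel]
  simp

/-- **`BSD(W,p)`, `r_an = 0`, `E[p]` irreducible, `p ∤ ∏ c_v`, `Sel^(p)(W/ℚ) = ⊥` ⟹ `ord_p(L(W,1)/Ω_W) = 0`** for every rational value `q` of
`L(W,1)/Ω_W` (for `q = 0` trivially). With §3/§4: on the cell, granted `BSD₂(W)`, **`Sel₂(W/ℚ) = ⊥ ⟺ ord₂(L(W,1)/Ω_W) = 0`**.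
[cite: Miller2011LMS, Def. 1.1] [cite: SilvermanAEC2009, Thm. X.4.2 (a)] -/
theorem padicValRat_lValue_eq_zero_of_bsdp_of_selmerGroup_eq_bot (hbsd : BSDp W p) (hr : W.analyticRank = 0) (hirr : Irr W p)
    (htam : ¬ p ∣ W.tamagawaProduct) (hSel : W.selmerGroup p = ⊥) {q : ℚ}
    (hL : W.entireLFunction 1 / (W.realPeriodRat : ℂ) = (q : ℂ)) : padicValRat p q = 0 := by
  rcases eq_or_ne q 0 with hq0 | hq0
  · rw [hq0, padicValRat.zero]
  have hr0 : W.mordellWeilRank = 0 := hbsd.1.trans hr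
  have h := padicValRat_shaAn_eq_zero_of_bsdp_of_selmerGroup_eq_bot W p hbsd hSel (shaAn_eq_of_analyticRank_eq_zero_of_lValue W hr0 hr hL)
  rwa [padicValRat_shaAn_eq_of_lValue W p hirr htam hq0] at h

/-- The `p = 2` cell form of the converse: `BSDp W 2`, `r_an = 0`, `ht`, `Odd (∏ c_v)`, `Sel₂(W/ℚ) = ⊥`, `L(W,1)/Ω_W = q` ⟹ `ord₂ q = 0`.
[cite: Miller2011LMS, Def. 1.1] [cite: SilvermanAEC2009, Thm. X.4.2 (a)] -/
theorem padicValRat_lValue_eq_zero_of_bsdp_two_of_selmerGroup_eq_bot (hbsd : BSDp W 2) (hr : W.analyticRank = 0)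
    (ht : ∀ x : ℚ, ¬ HasRationalTwoTorsionX W x) (htam : Odd W.tamagawaProduct) (hSel : W.selmerGroup 2 = ⊥) {q : ℚ}
    (hL : W.entireLFunction 1 / (W.realPeriodRat : ℂ) = (q : ℂ)) : padicValRat 2 q = 0 :=
  padicValRat_lValue_eq_zero_of_bsdp_of_selmerGroup_eq_bot W 2 hbsd hr (irr_two_of_forall_not_hasRationalTwoTorsionX W ht)
    (not_two_dvd_tamagawaProduct_of_odd W htam) hSel hL

end Summit.BirchSwinnertonDyer.BirchSwinnertonDyer.Theorems.AlignedTransportAtTwoSelmerTwoOfBSDp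

end
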